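import Summits.ValiantsHypothesis.ValiantsHypothesis.Theorems.LiftNullstellensatzLiftWidthPerFourTensorTrain
import Summits.ValiantsHypothesis.ValiantsHypothesis.Theorems.LiftNullstellensatzLiftWidthPerFourSameRow
import Summits.ValiantsHypothesis.ValiantsHypothesis.Theorems.LiftNullstellensatzLiftWidthPerFourClaimFStub
import Summits.ValiantsHypothesis.ValiantsHypothesis.Theorems.LiftNullstellensatzLiftWidthPerFourOuterLayers
import Summits.ValiantsHypothesis.ValiantsHypothesis.Theorems.LiftNullstellensatzLiftWidthPerFourCaseARows
import Summits.ValiantsHypothesis.ValiantsHypothesis.Theorems.LiftNullstellensatzLiftWidthPerFourCaseAOfVPlus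

/-!
# Crux `LiftWidthPerFour` (stmt-ValiantsHypothesis-5922) — skeleton of line `outer-layers`

`LiftWidthPerFour` = every word-lift of `per_4` has a sequential flattening of rank `≥ 6`
(Grenet's homogeneous-ABP format `(4,6,4)` is optimal at `n = 4`).  By Nisan's tensor-train normal
form (landed: `liftWidthPerFour_of_forall_abp`, p549949) it suffices that `per_4 ≠ L₁·L₂·L₃·L₄` for
matrices of LINEAR forms of sizes `1×a, a×b, b×c, c×1`, `a, b, c ≤ 5`.  The line normalises the two
OUTER layers and isolates one finite core:

* `stub_claimF` — CLAIM F (linear spaces on the permanental hypersurface): a linear subspace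
  `W ≤ M_4(ℂ)` of dimension `≥ 11` on which `per` vanishes identically lies in a coordinate space
  `{row i = 0}` or `{column j = 0}`.  (Guterman–Meshulam–Spiridonov 2023, Thm 1.7 is `dim W = 12`;
  `dim 11` by the same echelon method: F1 `exists_echelon_basis` p564056, F2
  `exists_permanent_ne_zero_of_echelon` p563705, Hall count p566003, defect chart A/B p567457/
  p567465 LANDED by val-width-5922-p1; C/D + wrapper outstanding — `Cruxes/LiftWidthPerFour/CLAIMF-p1.md`.)
* `stub_outerLayers` — the OUTER-LAYER NORMAL FORM from Claim F: if `per_4` lies in the ideal of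
  `a ≤ 5` linear forms `u_k` (as it does in the ideal of the entries of `L₁`, and of `L₄`), then that
  ideal is contained in a "row ideal" `(x_{i₀1},…,x_{i₀4}, ℓ)` or a "column ideal"
  `(x_{1j₀},…,x_{4j₀}, ℓ)` for ONE extra linear form `ℓ` (joint kernel of the `u_k` has dim `≥ 11`,
  `per` vanishes on it, Claim F, double annihilator).  Linear algebra, M-sized.
* `stub_caseA` — CASE A, the core (OPEN; numerically infeasible with margin `0.39·‖per_4‖`, 435
  calibrated ALS restarts, control format `(4,6,4)` converges 14/32 — `NUMERICS-p1.md`): `per_4` is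
  not a sum of `b ≤ 5` products `v_s · v'_s` of QUADRICS with `v_s ∈ (x_{i₀ ·}, ℓ)` and
  `v'_s ∈ (x_{i₁ ·}, ℓ')` for two DIFFERENT rows `i₀ ≠ i₁` (equivalently: no format-`(5,5,5)` ABP whose
  outer layers are of row type for two different rows).  The `5`-term / degree-`(2,2)` shape is
  essential: `per_4 ∈ (x_{i₀ ·})·(x_{i₁ ·})` trivially, and the `(1,3)` cut has only `4` terms.

Composition `LiftWidthPerFour_of : stub_claimF → stub_outerLayers → stub_caseA → LiftWidthPerFour`
(kernel-checked below, sorries only in the three stubs): normalise both outer layers; the four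
shape cases are  row/row-same (`perPoly_not_mem_rowIdeal_mul_rowIdeal`, p562896 ✓), row/column and
column/row (`perPoly_not_mem_rowIdeal_mul_colIdeal`, p562024 ✓, and commutativity of the ideal
product), column/column (transpose `x_{ij} ↦ x_{ji}`, which fixes `per_4`, reduces to the row
cases), and row/row-different = `stub_caseA` after regrouping the ABP at its middle cut.
v2 (prover val-width-5922-p2 g0, 2026-08-27, director-valiant's ruling 23:03Z "target of record for
`stub_caseA` = (V⁺)"): `stub_claimF` (p577199, val-width-5922-p1) and `stub_outerLayers` (p573304,
val-width-5922-p2) are LANDED and are now closed by name; `stub_caseA` is DERIVED in-skeleton from the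
one remaining stub `stub_vplus` = `(V⁺)(ℓ,ℓ')` for the rows `(0,3)`, stated with the named Prop
`Summit.ValiantsHypothesis.LiftNullstellensatz.CaseAVPlus 0 3 ℓ ℓ'` (Defs file p584212); the
derivation is `stub_caseA_of_caseAVPlus_zero_three` (p2: `(V⁺) ⇒ Case A` `caseA_rows_of_vplus` +
p1's row reduction `caseA_of_caseA_rows_zero_three`).  Rung 1.5 (`caseA_twoRow`, `…CaseATwoRow.lean`,
p585723): CASE A holds in exact form for all `ℓ, ℓ'` supported on the two rows (so `stub_vplus`
matters only for pairs with a component off the two rows); general `(ℓ,ℓ')` OPEN (`STAGED-CERT-p1g2.md`).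
VP ≠ VNP is not moved by this item (a finite calibration point of the LiftNullstellensatz ladder).
-/

noncomputable section

set_option linter.dupNamespace false

namespace Summit.ValiantsHypothesis.ValiantsHypothesis.Cruxes.LiftWidthPerFour.OuterLayers

open MvPolynomial Literature.Computability.AlgebraicComplexity
open Summit.ValiantsHypothesis.LiftNullstellensatz

/-- STUB F (Claim F — linear spaces of dimension `≥ 11` on `Z(per_4)` are coordinate): every linear
subspace `W ≤ M_4(ℂ)` with `dim W ≥ 11` and `per|_W ≡ 0` lies in `{row i₀ = 0}` or in
`{column j₀ = 0}`.  Proof plan complete (CLAIMF-p1.md: echelon basis, no transversal, Hall count,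
defect chart); `dim W = 12` is Guterman–Meshulam–Spiridonov 2023 Thm 1.7.
[cite: GutermanMeshulamSpiridonov2023, Thm. 1.7 (method)] -/
theorem stub_claimF :
    ∀ W : Submodule ℂ (Matrix (Fin 4) (Fin 4) ℂ), 11 ≤ Module.finrank ℂ W →
      (∀ A ∈ W, A.permanent = 0) →
      (∃ i₀ : Fin 4, ∀ A ∈ W, ∀ j, A i₀ j = 0) ∨ (∃ j₀ : Fin 4, ∀ A ∈ W, ∀ i, A i j₀ = 0) :=
  Summit.ValiantsHypothesis.LiftNullstellensatz.stub_claimF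

/-- STUB N (outer-layer normal form from Claim F): if `per_4` lies in the ideal generated by
`a ≤ 5` linear forms `u_k`, then `(u_1,…,u_a) ⊆ (x_{i₀ 1},…,x_{i₀ 4}, ℓ)` or
`⊆ (x_{1 j₀},…,x_{4 j₀}, ℓ)` for some linear form `ℓ` (possibly `0`).  Bridge: the joint kernel
`W` of the `u_k` has `dim W ≥ 16 - a ≥ 11` and `per|_W ≡ 0` (evaluate the membership); Claim F;
each `x_{i₀ j}` vanishes on `W`, hence lies in `span(u_k)` (double annihilator,
`Submodule.mem_span_of_iInf_ker_le_ker`); `dim span(u_k) ≤ 5`. [folklore] -/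
theorem stub_outerLayers :
    (∀ W : Submodule ℂ (Matrix (Fin 4) (Fin 4) ℂ), 11 ≤ Module.finrank ℂ W →
      (∀ A ∈ W, A.permanent = 0) →
      (∃ i₀ : Fin 4, ∀ A ∈ W, ∀ j, A i₀ j = 0) ∨ (∃ j₀ : Fin 4, ∀ A ∈ W, ∀ i, A i j₀ = 0)) →
    ∀ a : ℕ, a ≤ 5 → ∀ u : Fin a → MvPolynomial (Fin 4 × Fin 4) ℂ,
      (∀ k, (u k).IsHomogeneous 1) → perPoly (Fin 4) ℂ ∈ Ideal.span (Set.range u) →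
      ∃ ℓ : MvPolynomial (Fin 4 × Fin 4) ℂ, ℓ.IsHomogeneous 1 ∧
        ((∃ i₀ : Fin 4, Ideal.span (Set.range u) ≤
            Ideal.span (insert ℓ (Set.range fun j : Fin 4 =>
              (X (i₀, j) : MvPolynomial (Fin 4 × Fin 4) ℂ)))) ∨
         (∃ j₀ : Fin 4, Ideal.span (Set.range u) ≤
            Ideal.span (insert ℓ (Set.range fun i : Fin 4 =>
              (X (i, j₀) : MvPolynomial (Fin 4 × Fin 4) ℂ))))) :=
  Summit.ValiantsHypothesis.LiftNullstellensatz.stub_outerLayers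

/-- STUB V⁺ (the uniform staged target for CASE A, rows `(0,3)`; OPEN): for all linear forms `ℓ, ℓ'`
and all `5 × 5` matrices `L₂, L₃` of linear forms, `per_4 − X̂ᵀ L₂ L₃ Ξ̂ ∉ 𝔪_X · 𝔪_Ξ · (𝔪_X + 𝔪_Ξ)²`
where `X̂ = (ℓ, x_{0,·})`, `Ξ̂ = (ℓ', x_{3,·})`, `𝔪_X = (X̂)`, `𝔪_Ξ = (Ξ̂)` — i.e.
`∀ ℓ ℓ', CaseAVPlus 0 3 ℓ ℓ'` (named Prop of the Defs file `…OuterLayersDefs.lean`, p584212).  Stages 1 ∧ 2 of the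
Taylor tower of `per_4 = X̂ᵀ L₂ L₃ Ξ̂` along `V(X̂, Ξ̂)` (`STAGED-CERT-p1g2.md` §7).  Proved for
`ℓ = ℓ' = 0` in exact form (`caseA_zero`); exceptional pairs `(ℓ,ℓ') = (y_a + u·ξ, y_b + u'·x)` under
attack by ℚ-certificates (val-width-5922-p1 g2); why it might fail: a width-`5` program matching
`per_4` to second order along some `V(X̂, Ξ̂)` without being exact.
[cite: BlaserIkenmeyerMahajanPandeySaurabh2020, §2 (problem)] -/
theorem stub_vplus :
    ∀ ℓ ℓ' : MvPolynomial (Fin 4 × Fin 4) ℂ, ℓ.IsHomogeneous 1 → ℓ'.IsHomogeneous 1 →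
      CaseAVPlus 0 3 ℓ ℓ' := by
  sorry

/-- STUB A (Case A — the finite core), v2: DERIVED from `stub_vplus` (`(V⁺)` for the rows `(0,3)`)
via `caseA_rows_of_vplus` and the row reduction `caseA_of_caseA_rows_zero_three`.  Statement: for two different rows `i₀ ≠ i₁` and any linear forms
`ℓ, ℓ'`, `per_4` is not a sum of `b ≤ 5` products of quadrics `v_s ∈ (x_{i₀ ·}, ℓ)`,
`v'_s ∈ (x_{i₁ ·}, ℓ')`.  Equivalently: no homogeneous ABP of format `(≤5, ≤5, ≤5)` for `per_4` has
row-type outer layers for two different rows.  First rung: `ℓ = ℓ' = 0` (format `(4,5,4)`,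
the `32 × 32` rank-`5` completion problem `P_A` of REDUCTION-p1.md R4).  Why it might fail: a
non-Grenet width-`5` program in this normal form (none found: NUMERICS-p1.md).
[cite: BlaserIkenmeyerMahajanPandeySaurabh2020, §2 (problem)] -/
theorem stub_caseA :
    ∀ b : ℕ, b ≤ 5 → ∀ i₀ i₁ : Fin 4, i₀ ≠ i₁ →
      ∀ ℓ ℓ' : MvPolynomial (Fin 4 × Fin 4) ℂ, ℓ.IsHomogeneous 1 → ℓ'.IsHomogeneous 1 →
      ∀ v v' : Fin b → MvPolynomial (Fin 4 × Fin 4) ℂ,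
        (∀ s, v s ∈ Ideal.span (insert ℓ (Set.range fun j : Fin 4 =>
          (X (i₀, j) : MvPolynomial (Fin 4 × Fin 4) ℂ)))) →
        (∀ s, (v s).IsHomogeneous 2) →
        (∀ s, v' s ∈ Ideal.span (insert ℓ' (Set.range fun j : Fin 4 =>
          (X (i₁, j) : MvPolynomial (Fin 4 × Fin 4) ℂ)))) →
        (∀ s, (v' s).IsHomogeneous 2) →
        perPoly (Fin 4) ℂ ≠ ∑ s, v s * v' s :=
  stub_caseA_of_caseAVPlus_zero_three stub_vplus

/-- A linear form `Σ_x c_x · x` is homogeneous of degree `1`. [folklore] -/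
theorem isHomogeneous_sum_smul_X (c : Fin 4 × Fin 4 → ℂ) :
    (∑ x, c x • (X x : MvPolynomial (Fin 4 × Fin 4) ℂ)).IsHomogeneous 1 := by
  refine IsHomogeneous.sum _ _ _ fun x _ => ?_
  rw [smul_eq_C_mul]
  exact (isHomogeneous_X ℂ x).C_mul _

/-- The generic `4 × 4` permanent is symmetric: `per(xᵀ) = per(x)`. [folklore] -/
theorem rename_swap_perPoly_four :
    rename Prod.swap (perPoly (Fin 4) ℂ) = perPoly (Fin 4) ℂ := by
  have h : rename (Prod.swap : Fin 4 × Fin 4 → Fin 4 × Fin 4) (perPoly (Fin 4) ℂ) =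
      ((Matrix.mvPolynomialX (Fin 4) (Fin 4) ℂ).transpose).permanent := by
    simp [perPoly, Matrix.permanent, map_sum, map_prod, Matrix.mvPolynomialX, rename_X]
  rw [h, Matrix.permanent_transpose]
  rfl

/-- The transpose `x_{ij} ↦ x_{ji}` maps a column ideal `(x_{· j}, m)` into the row ideal
`(x_{j ·}, mᵀ)`. [folklore] -/
theorem map_swap_colIdeal_le (j : Fin 4) (m : MvPolynomial (Fin 4 × Fin 4) ℂ) :
    Ideal.map (rename Prod.swap : MvPolynomial (Fin 4 × Fin 4) ℂ →ₐ[ℂ] MvPolynomial (Fin 4 × Fin 4) ℂ)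
        (Ideal.span (insert m (Set.range fun i : Fin 4 =>
          (X (i, j) : MvPolynomial (Fin 4 × Fin 4) ℂ)))) ≤
      Ideal.span (insert (rename Prod.swap m) (Set.range fun i : Fin 4 =>
        (X (j, i) : MvPolynomial (Fin 4 × Fin 4) ℂ))) := by
  rw [Ideal.map_span, Ideal.span_le]
  rintro _ ⟨f, hf, rfl⟩
  rcases hf with rfl | ⟨i, rfl⟩
  · exact Ideal.subset_span (Set.mem_insert _ _)
  · refine Ideal.subset_span (Set.mem_insert_of_mem _ ⟨i, ?_⟩)
    simp [rename_X]

/-- **The case analysis behind the line** (all four outer-layer shapes): given the outer-layer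
normal form (stub N, as a hypothesis) and Case A (stub A, as a hypothesis), `per_4` is not a
product `L₁ L₂ L₃ L₄` of matrices of linear forms of format `(a, b, c)` with `a, b, c ≤ 5`.
[folklore] -/
theorem perPoly_ne_abp_of {a b c : ℕ} (ha : a ≤ 5) (hb : b ≤ 5) (hc : c ≤ 5)
    (l₁ : Fin a → MvPolynomial (Fin 4 × Fin 4) ℂ)
    (l₂ : Fin a → Fin b → MvPolynomial (Fin 4 × Fin 4) ℂ)
    (l₃ : Fin b → Fin c → MvPolynomial (Fin 4 × Fin 4) ℂ)
    (l₄ : Fin c → MvPolynomial (Fin 4 × Fin 4) ℂ)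
    (h₁ : ∀ k, (l₁ k).IsHomogeneous 1) (h₂ : ∀ k s, (l₂ k s).IsHomogeneous 1)
    (h₃ : ∀ s t, (l₃ s t).IsHomogeneous 1) (h₄ : ∀ t, (l₄ t).IsHomogeneous 1)
    (hN : ∀ a : ℕ, a ≤ 5 → ∀ u : Fin a → MvPolynomial (Fin 4 × Fin 4) ℂ,
      (∀ k, (u k).IsHomogeneous 1) → perPoly (Fin 4) ℂ ∈ Ideal.span (Set.range u) →
      ∃ ℓ : MvPolynomial (Fin 4 × Fin 4) ℂ, ℓ.IsHomogeneous 1 ∧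
        ((∃ i₀ : Fin 4, Ideal.span (Set.range u) ≤
            Ideal.span (insert ℓ (Set.range fun j : Fin 4 =>
              (X (i₀, j) : MvPolynomial (Fin 4 × Fin 4) ℂ)))) ∨
         (∃ j₀ : Fin 4, Ideal.span (Set.range u) ≤
            Ideal.span (insert ℓ (Set.range fun i : Fin 4 =>
              (X (i, j₀) : MvPolynomial (Fin 4 × Fin 4) ℂ))))))
    (hA : ∀ b : ℕ, b ≤ 5 → ∀ i₀ i₁ : Fin 4, i₀ ≠ i₁ →
      ∀ ℓ ℓ' : MvPolynomial (Fin 4 × Fin 4) ℂ, ℓ.IsHomogeneous 1 → ℓ'.IsHomogeneous 1 →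
      ∀ v v' : Fin b → MvPolynomial (Fin 4 × Fin 4) ℂ,
        (∀ s, v s ∈ Ideal.span (insert ℓ (Set.range fun j : Fin 4 =>
          (X (i₀, j) : MvPolynomial (Fin 4 × Fin 4) ℂ)))) →
        (∀ s, (v s).IsHomogeneous 2) →
        (∀ s, v' s ∈ Ideal.span (insert ℓ' (Set.range fun j : Fin 4 =>
          (X (i₁, j) : MvPolynomial (Fin 4 × Fin 4) ℂ)))) →
        (∀ s, (v' s).IsHomogeneous 2) →
        perPoly (Fin 4) ℂ ≠ ∑ s, v s * v' s) :
    perPoly (Fin 4) ℂ ≠ ∑ k, ∑ s, ∑ t, l₁ k * l₂ k s * l₃ s t * l₄ t := by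
  classical
  intro hper
  -- the outer ideals
  set I : Ideal (MvPolynomial (Fin 4 × Fin 4) ℂ) := Ideal.span (Set.range l₁) with hIdef
  set J : Ideal (MvPolynomial (Fin 4 × Fin 4) ℂ) := Ideal.span (Set.range l₄) with hJdef
  have hl₁I : ∀ k, l₁ k ∈ I := fun k => Ideal.subset_span ⟨k, rfl⟩
  have hl₄J : ∀ t, l₄ t ∈ J := fun t => Ideal.subset_span ⟨t, rfl⟩
  have hI : perPoly (Fin 4) ℂ ∈ I := by
    rw [hper]
    exact Ideal.sum_mem _ fun k _ => Ideal.sum_mem _ fun s _ => Ideal.sum_mem _ fun t _ =>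
      Ideal.mul_mem_right _ _ (Ideal.mul_mem_right _ _ (Ideal.mul_mem_right _ _ (hl₁I k)))
  have hJ : perPoly (Fin 4) ℂ ∈ J := by
    rw [hper]
    exact Ideal.sum_mem _ fun k _ => Ideal.sum_mem _ fun s _ => Ideal.sum_mem _ fun t _ =>
      Ideal.mul_mem_left _ _ (hl₄J t)
  have hIJ : perPoly (Fin 4) ℂ ∈ I * J := by
    rw [hper]
    exact Ideal.sum_mem _ fun k _ => Ideal.sum_mem _ fun s _ => Ideal.sum_mem _ fun t _ =>
      Ideal.mul_mem_mul (Ideal.mul_mem_right _ _ (Ideal.mul_mem_right _ _ (hl₁I k))) (hl₄J t)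
  -- the middle cut: `per_4 = Σ_s v_s v'_s` with quadrics `v_s ∈ I`, `v'_s ∈ J`
  have hmid : perPoly (Fin 4) ℂ = ∑ s, (∑ k, l₁ k * l₂ k s) * (∑ t, l₃ s t * l₄ t) := by
    rw [hper, Finset.sum_comm]
    refine Finset.sum_congr rfl fun s _ => ?_
    rw [Finset.sum_mul_sum]
    refine Finset.sum_congr rfl fun k _ => Finset.sum_congr rfl fun t _ => ?_
    ring
  have hv : ∀ s, (∑ k, l₁ k * l₂ k s) ∈ I := fun s =>
    Ideal.sum_mem _ fun k _ => Ideal.mul_mem_right _ _ (hl₁I k)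
  have hv2 : ∀ s, (∑ k, l₁ k * l₂ k s).IsHomogeneous 2 := fun s =>
    IsHomogeneous.sum _ _ _ fun k _ => (h₁ k).mul (h₂ k s)
  have hv' : ∀ s, (∑ t, l₃ s t * l₄ t) ∈ J := fun s =>
    Ideal.sum_mem _ fun t _ => Ideal.mul_mem_left _ _ (hl₄J t)
  have hv'2 : ∀ s, (∑ t, l₃ s t * l₄ t).IsHomogeneous 2 := fun s =>
    IsHomogeneous.sum _ _ _ fun t _ => (h₃ s t).mul (h₄ t)
  -- normalise both outer layers
  obtain ⟨ℓ, hℓ, hcase₁⟩ := hN a ha l₁ h₁ hI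
  obtain ⟨ℓ', hℓ', hcase₄⟩ := hN c hc l₄ h₄ hJ
  have h2 : (2 : ℂ) ≠ 0 := two_ne_zero
  rcases hcase₁ with ⟨i₀, hi₀⟩ | ⟨j₀, hj₀⟩ <;> rcases hcase₄ with ⟨i₁, hi₁⟩ | ⟨j₁, hj₁⟩
  · -- row / row
    by_cases heq : i₀ = i₁
    · subst heq
      exact perPoly_not_mem_rowIdeal_mul_rowIdeal h2 i₀ ℓ ℓ' hℓ hℓ' (Ideal.mul_mono hi₀ hi₁ hIJ)
    · exact hA b hb i₀ i₁ heq ℓ ℓ' hℓ hℓ' _ _ (fun s => hi₀ (hv s)) hv2 (fun s => hi₁ (hv' s))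
        hv'2 hmid
  · -- row / column
    exact perPoly_not_mem_rowIdeal_mul_colIdeal h2 i₀ j₁ ℓ ℓ' hℓ hℓ' (Ideal.mul_mono hi₀ hj₁ hIJ)
  · -- column / row
    have hJI : perPoly (Fin 4) ℂ ∈ J * I := mul_comm I J ▸ hIJ
    exact perPoly_not_mem_rowIdeal_mul_colIdeal h2 i₁ j₀ ℓ' ℓ hℓ' hℓ (Ideal.mul_mono hi₁ hj₀ hJI)
  · -- column / column: transpose the variable matrix
    set τ : MvPolynomial (Fin 4 × Fin 4) ℂ →ₐ[ℂ] MvPolynomial (Fin 4 × Fin 4) ℂ :=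
      rename Prod.swap with hτdef
    have hτper : τ (perPoly (Fin 4) ℂ) = perPoly (Fin 4) ℂ := rename_swap_perPoly_four
    by_cases heq : j₀ = j₁
    · subst heq
      have h1 : τ (perPoly (Fin 4) ℂ) ∈
          Ideal.map τ (Ideal.span (insert ℓ (Set.range fun i : Fin 4 =>
            (X (i, j₀) : MvPolynomial (Fin 4 × Fin 4) ℂ)))) *
          Ideal.map τ (Ideal.span (insert ℓ' (Set.range fun i : Fin 4 =>
            (X (i, j₀) : MvPolynomial (Fin 4 × Fin 4) ℂ)))) := by
        rw [← Ideal.map_mul]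
        exact Ideal.mem_map_of_mem _ (Ideal.mul_mono hj₀ hj₁ hIJ)
      rw [hτper] at h1
      exact perPoly_not_mem_rowIdeal_mul_rowIdeal h2 j₀ (τ ℓ) (τ ℓ') hℓ.rename_isHomogeneous
        hℓ'.rename_isHomogeneous
        (Ideal.mul_mono (map_swap_colIdeal_le j₀ ℓ) (map_swap_colIdeal_le j₀ ℓ') h1)
    · have hmid' : perPoly (Fin 4) ℂ =
          ∑ s, τ (∑ k, l₁ k * l₂ k s) * τ (∑ t, l₃ s t * l₄ t) := by
        calc perPoly (Fin 4) ℂ = τ (perPoly (Fin 4) ℂ) := hτper.symm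
          _ = τ (∑ s, (∑ k, l₁ k * l₂ k s) * (∑ t, l₃ s t * l₄ t)) := by rw [← hmid]
          _ = ∑ s, τ (∑ k, l₁ k * l₂ k s) * τ (∑ t, l₃ s t * l₄ t) := by
            rw [map_sum]
            exact Finset.sum_congr rfl fun s _ => map_mul τ _ _
      exact hA b hb j₀ j₁ heq (τ ℓ) (τ ℓ') hℓ.rename_isHomogeneous hℓ'.rename_isHomogeneous _ _
        (fun s => map_swap_colIdeal_le j₀ ℓ (Ideal.mem_map_of_mem _ (hj₀ (hv s))))
        (fun s => (hv2 s).rename_isHomogeneous)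
        (fun s => map_swap_colIdeal_le j₁ ℓ' (Ideal.mem_map_of_mem _ (hj₁ (hv' s))))
        (fun s => (hv'2 s).rename_isHomogeneous) hmid'

/-- **Composition of the line**: `stub_claimF → stub_outerLayers → stub_caseA → LiftWidthPerFour`,
through Nisan's ABP normal form `liftWidthPerFour_of_forall_abp`. [folklore] -/
theorem LiftWidthPerFour_of
    (hF : ∀ W : Submodule ℂ (Matrix (Fin 4) (Fin 4) ℂ), 11 ≤ Module.finrank ℂ W →
      (∀ A ∈ W, A.permanent = 0) →
      (∃ i₀ : Fin 4, ∀ A ∈ W, ∀ j, A i₀ j = 0) ∨ (∃ j₀ : Fin 4, ∀ A ∈ W, ∀ i, A i j₀ = 0))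
    (hN : (∀ W : Submodule ℂ (Matrix (Fin 4) (Fin 4) ℂ), 11 ≤ Module.finrank ℂ W →
      (∀ A ∈ W, A.permanent = 0) →
      (∃ i₀ : Fin 4, ∀ A ∈ W, ∀ j, A i₀ j = 0) ∨ (∃ j₀ : Fin 4, ∀ A ∈ W, ∀ i, A i j₀ = 0)) →
    ∀ a : ℕ, a ≤ 5 → ∀ u : Fin a → MvPolynomial (Fin 4 × Fin 4) ℂ,
      (∀ k, (u k).IsHomogeneous 1) → perPoly (Fin 4) ℂ ∈ Ideal.span (Set.range u) →
      ∃ ℓ : MvPolynomial (Fin 4 × Fin 4) ℂ, ℓ.IsHomogeneous 1 ∧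
        ((∃ i₀ : Fin 4, Ideal.span (Set.range u) ≤
            Ideal.span (insert ℓ (Set.range fun j : Fin 4 =>
              (X (i₀, j) : MvPolynomial (Fin 4 × Fin 4) ℂ)))) ∨
         (∃ j₀ : Fin 4, Ideal.span (Set.range u) ≤
            Ideal.span (insert ℓ (Set.range fun i : Fin 4 =>
              (X (i, j₀) : MvPolynomial (Fin 4 × Fin 4) ℂ))))))
    (hA : ∀ b : ℕ, b ≤ 5 → ∀ i₀ i₁ : Fin 4, i₀ ≠ i₁ →
      ∀ ℓ ℓ' : MvPolynomial (Fin 4 × Fin 4) ℂ, ℓ.IsHomogeneous 1 → ℓ'.IsHomogeneous 1 →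
      ∀ v v' : Fin b → MvPolynomial (Fin 4 × Fin 4) ℂ,
        (∀ s, v s ∈ Ideal.span (insert ℓ (Set.range fun j : Fin 4 =>
          (X (i₀, j) : MvPolynomial (Fin 4 × Fin 4) ℂ)))) →
        (∀ s, (v s).IsHomogeneous 2) →
        (∀ s, v' s ∈ Ideal.span (insert ℓ' (Set.range fun j : Fin 4 =>
          (X (i₁, j) : MvPolynomial (Fin 4 × Fin 4) ℂ)))) →
        (∀ s, (v' s).IsHomogeneous 2) →
        perPoly (Fin 4) ℂ ≠ ∑ s, v s * v' s) :
    Summit.ValiantsHypothesis.ValiantsHypothesis.Theses.LiftNullstellensatz.LiftWidthPerFour :=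
  liftWidthPerFour_of_forall_abp fun _ _ _ ha hb hc L₁ L₂ L₃ L₄ =>
    perPoly_ne_abp_of ha hb hc (fun k => ∑ x, L₁ x k • (X x : MvPolynomial (Fin 4 × Fin 4) ℂ))
      (fun k s => ∑ x, L₂ x k s • (X x : MvPolynomial (Fin 4 × Fin 4) ℂ))
      (fun s t => ∑ x, L₃ x s t • (X x : MvPolynomial (Fin 4 × Fin 4) ℂ))
      (fun t => ∑ x, L₄ x t • (X x : MvPolynomial (Fin 4 × Fin 4) ℂ))
      (fun _ => isHomogeneous_sum_smul_X _) (fun _ _ => isHomogeneous_sum_smul_X _)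
      (fun _ _ => isHomogeneous_sum_smul_X _) (fun _ => isHomogeneous_sum_smul_X _) (hN hF) hA

/-- The line closes the crux BY NAME from its stubs (v2: the only open one is `stub_vplus`). [folklore] -/
theorem LiftWidthPerFour_of_line :
    Summit.ValiantsHypothesis.ValiantsHypothesis.Theses.LiftNullstellensatz.LiftWidthPerFour :=
  LiftWidthPerFour_of stub_claimF stub_outerLayers stub_caseA

end Summit.ValiantsHypothesis.ValiantsHypothesis.Cruxes.LiftWidthPerFour.OuterLayers

end
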